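import Literature.Barriers.CriticalPhenomena.FKParafermionicHalfCauchyRiemann

/-!
# `EdgeCoherence` (stmt-CriticalPhenomena-11385): the vertex relation in `ℤ₄`-harmonics —
# which corner-class harmonics the known half of Cauchy–Riemann sees

Crux-triage certificate (triager 2, round 1; findings C1–C3 of `Cruxes/EdgeCoherence/TRIAGE-r1-2.md`).
For ANY function `F` on corners (medial edges) write, at a lattice site `v`, the four corner values
`E_j(v) = F (v, f_j(v))` with the faces `f_j(v) = v, v - e₀, v - e₀ - e₁, v - e₁` listed
counter-clockwise from north-east (`cornerFaces`, verbatim the crux sketches' convention), and the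
four `ℤ₄`-harmonics `H_k(v) = Σ_j i^{kj} E_j(v)`, spelled out:
`H₀ = E₀+E₁+E₂+E₃`, `H₁ = E₀+iE₁-E₂-iE₃`, `H₂ = E₀-E₁+E₂-E₃`, `H₃ = E₀-iE₁-E₂+iE₃`.
Then, purely algebraically (no probability, no observable):

* `four_mul_halfCR_horizontal` / `four_mul_halfCR_vertical`: the printed vertex relation
  `F(NW) - F(SE) = i (F(NE) - F(SW))` of the barrier file (`HalfCRRelationAt Complex.I`, corner
  table `medialCornersAt`) at the horizontal medial vertex `s(x, x+e₀)` (resp. vertical `s(x, x+e₁)`)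
  is, times `4`, the identity
  `2 (H₃(x) + H₃(x+e₀)) - (1+i)(H₀(x+e₀) - H₀(x)) - (1-i)(H₂(x+e₀) - H₂(x))`
  (resp. `2 (H₃(x) + H₃(x+e₁)) - (1-i)(H₀(x+e₁) - H₀(x)) - (1+i)(H₂(x+e₁) - H₂(x))`):
  the harmonic `H₁` NEVER APPEARS (it is the coefficient along the barrier's kernel direction
  `HalfCRKernel.vertexKernel i v`, see `harmonics_vertexKernel`), and `H₃` is SLAVED to lattice
  gradients of `H₀, H₂` — so with the chirality `i` the relations constrain `H₀, H₂, H₃` only;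
  `halfCRRelationAt_I_horizontal_iff` / `_vertical_iff` are the equivalent `↔` forms.
* `sum_medialCornersAt_horizontal` / `_vertical`: the plain sum of the four corner values at a
  medial vertex (which is `2 cos(π/12)` times the route's spin-`1/3` VERTEX observable, refuter note
  g43-2 on the item) equals `½ (H₀(x) + H₀(x')) ± ¼ (1±i)(H₁(x) - H₁(x')) + ¼ (1∓i)(H₃(x) - H₃(x'))`:
  it contains NO `H₂` and sees `H₁, H₃` only through lattice gradients.
Consequence recorded in the triage file (C3): summing the relations against a test function, the
weak `∂̄` of `H₀` equals `i` times the weak `∂` of `H₂` up to `O(δ⁻¹ sup|H₃|)` and `O(1)` lattice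
errors, so the route's `WeakHolomorphy` consumes only `H₂, H₃ = o(δ^{1/3})`; `H₁ → 0` (the
numerically dominant alias demanded by `EdgeCoherence` with `u ≡ 1`) is not used downstream.
-/

noncomputable section

open Literature.Probability.LatticeModels Literature.Barriers.CriticalPhenomena

namespace Summit.CriticalPhenomena.CardyFormulaZ2.Theorems.EdgeCoherence.Negative.HalfCRHarmonics

/-- The unit vector `e₀`. [folklore] -/
abbrev e₀ : Site 2 := Pi.single 0 1
/-- The unit vector `e₁`. [folklore] -/
abbrev e₁ : Site 2 := Pi.single 1 1

variable (F : Site 2 × Site 2 → ℂ)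

/-- Corner value of class `0` (face north-east of `v`, travel NW). [folklore] -/
def E0 (v : Site 2) : ℂ := F (v, v)
/-- Corner value of class `1` (face north-west of `v`, travel SW). [folklore] -/
def E1 (v : Site 2) : ℂ := F (v, v - e₀)
/-- Corner value of class `2` (face south-west of `v`, travel SE). [folklore] -/
def E2 (v : Site 2) : ℂ := F (v, v - e₀ - e₁)
/-- Corner value of class `3` (face south-east of `v`, travel NE). [folklore] -/
def E3 (v : Site 2) : ℂ := F (v, v - e₁)

/-- `H₀ = Σ_j E_j` (the spin-`1/3` signal). [folklore] -/
def H0 (v : Site 2) : ℂ := E0 F v + E1 F v + E2 F v + E3 F v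
/-- `H₁ = Σ_j i^j E_j` (the spin-`2/3` alias, the `vertexKernel` direction). [folklore] -/
def H1 (v : Site 2) : ℂ := E0 F v + Complex.I * E1 F v - E2 F v - Complex.I * E3 F v
/-- `H₂ = Σ_j (-1)^j E_j` (the spin-`5/3` alias, the alternating component). [folklore] -/
def H2 (v : Site 2) : ℂ := E0 F v - E1 F v + E2 F v - E3 F v
/-- `H₃ = Σ_j i^{3j} E_j = Σ_j (-i)^j E_j` (the spin-`4/3` alias, slaved by the relation). [folklore] -/
def H3 (v : Site 2) : ℂ := E0 F v - Complex.I * E1 F v - E2 F v + Complex.I * E3 F v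

/-- Fourier inversion on `ℤ₄`: `4 E₀ = H₀ + H₁ + H₂ + H₃`. [folklore] -/
theorem four_mul_E0 (v : Site 2) : 4 * E0 F v = H0 F v + H1 F v + H2 F v + H3 F v := by
  simp only [H0, H1, H2, H3]; ring

/-- Fourier inversion on `ℤ₄`: `4 E₂ = H₀ - H₁ + H₂ - H₃`. [folklore] -/
theorem four_mul_E2 (v : Site 2) : 4 * E2 F v = H0 F v - H1 F v + H2 F v - H3 F v := by
  simp only [H0, H1, H2, H3]; ring

/-- Fourier inversion on `ℤ₄`: `4 E₁ = H₀ - i H₁ - H₂ + i H₃`. [folklore] -/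
theorem four_mul_E1 (v : Site 2) :
    4 * E1 F v = H0 F v - Complex.I * H1 F v - H2 F v + Complex.I * H3 F v := by
  simp only [H0, H1, H2, H3]
  have h := Complex.I_mul_I
  linear_combination (2 * E1 F v - 2 * E3 F v) * h

/-- Fourier inversion on `ℤ₄`: `4 E₃ = H₀ + i H₁ - H₂ - i H₃`. [folklore] -/
theorem four_mul_E3 (v : Site 2) :
    4 * E3 F v = H0 F v + Complex.I * H1 F v - H2 F v - Complex.I * H3 F v := by
  simp only [H0, H1, H2, H3]
  have h := Complex.I_mul_I
  linear_combination (2 * E3 F v - 2 * E1 F v) * h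

/-! ## The horizontal medial vertex `s(x, x + e₀)` -/

/-- The barrier's corner table at a horizontal medial vertex, in class coordinates:
`NW = E₀(x)`, `NE = E₁(x+e₀)`, `SE = E₂(x+e₀)`, `SW = E₃(x)`. [folklore] -/
theorem medialCornersAt_horizontal (x : Site 2) :
    F (medialCornersAt x 0 0) = E0 F x ∧ F (medialCornersAt x 0 1) = E1 F (x + e₀) ∧
      F (medialCornersAt x 0 2) = E2 F (x + e₀) ∧ F (medialCornersAt x 0 3) = E3 F x := by
  have p0 : medialCornersAt x 0 0 = (x, x) := by
    simp [medialCornersAt]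
  have p1 : medialCornersAt x 0 1 = (x + e₀, x + e₀ - e₀) := by
    rw [add_sub_cancel_right]; simp [medialCornersAt]
  have p2 : medialCornersAt x 0 2 = (x + e₀, x + e₀ - e₀ - e₁) := by
    rw [add_sub_cancel_right]; simp [medialCornersAt]
  have p3 : medialCornersAt x 0 3 = (x, x - e₁) := by
    simp [medialCornersAt]
  simp only [E0, E1, E2, E3, p0, p1, p2, p3, and_self]

/-- **The horizontal relation in harmonics** (an identity for every `F`):
`4·[F(NW) - F(SE) - i(F(NE) - F(SW))] = 2(H₃(x)+H₃(x+e₀)) - (1+i)(H₀(x+e₀)-H₀(x)) - (1-i)(H₂(x+e₀)-H₂(x))`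
— no `H₁`. [folklore] -/
theorem four_mul_halfCR_horizontal (x : Site 2) :
    4 * (F (medialCornersAt x 0 0) - F (medialCornersAt x 0 2) -
        Complex.I * (F (medialCornersAt x 0 1) - F (medialCornersAt x 0 3))) =
      2 * (H3 F x + H3 F (x + e₀)) - (1 + Complex.I) * (H0 F (x + e₀) - H0 F x) -
        (1 - Complex.I) * (H2 F (x + e₀) - H2 F x) := by
  obtain ⟨h0, h1, h2, h3⟩ := medialCornersAt_horizontal F x
  rw [h0, h1, h2, h3]
  simp only [H0, H2, H3]
  ring

/-- The printed relation with chirality `i` at `s(x, x+e₀)` ⟺ the `H₁`-free harmonic identity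
`(1+i) ∂₀H₀ + (1-i) ∂₀H₂ = 2 (H₃(x) + H₃(x+e₀))`. [folklore] -/
theorem halfCRRelationAt_I_horizontal_iff (x : Site 2) :
    HalfCRRelationAt Complex.I F (x, 0) ↔
      (1 + Complex.I) * (H0 F (x + e₀) - H0 F x) + (1 - Complex.I) * (H2 F (x + e₀) - H2 F x) =
        2 * (H3 F x + H3 F (x + e₀)) := by
  have key := four_mul_halfCR_horizontal F x
  simp only [HalfCRRelationAt]
  constructor
  · intro h
    have : 4 * (F (medialCornersAt x 0 0) - F (medialCornersAt x 0 2) -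
        Complex.I * (F (medialCornersAt x 0 1) - F (medialCornersAt x 0 3))) = 0 := by
      rw [h]; ring
    rw [this] at key
    linear_combination key
  · intro h
    have : 4 * (F (medialCornersAt x 0 0) - F (medialCornersAt x 0 2) -
        Complex.I * (F (medialCornersAt x 0 1) - F (medialCornersAt x 0 3))) = 0 := by
      rw [key]; linear_combination -h
    have h4 : (4 : ℂ) ≠ 0 := by norm_num
    have := (mul_eq_zero.1 this).resolve_left h4
    linear_combination this

/-- **The vertex sum at a horizontal medial vertex** (`= 2cos(π/12)·F_δ(z)` for the route's vertex
observable): `4 Σ_k F(corner k) = 2(H₀(x)+H₀(x+e₀)) + (1+i)(H₁(x)-H₁(x+e₀)) + (1-i)(H₃(x)-H₃(x+e₀))`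
— no `H₂`, and `H₁, H₃` only through lattice differences. [folklore] -/
theorem four_mul_sum_medialCornersAt_horizontal (x : Site 2) :
    4 * (F (medialCornersAt x 0 0) + F (medialCornersAt x 0 1) + F (medialCornersAt x 0 2) +
        F (medialCornersAt x 0 3)) =
      2 * (H0 F x + H0 F (x + e₀)) + (1 + Complex.I) * (H1 F x - H1 F (x + e₀)) +
        (1 - Complex.I) * (H3 F x - H3 F (x + e₀)) := by
  obtain ⟨h0, h1, h2, h3⟩ := medialCornersAt_horizontal F x
  rw [h0, h1, h2, h3]
  simp only [H0, H1, H3]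
  have h := Complex.I_mul_I
  linear_combination (2 * E1 F (x + e₀) + 2 * E3 F x - 2 * E1 F x - 2 * E3 F (x + e₀)) * h

/-! ## The vertical medial vertex `s(x, x + e₁)` -/

/-- The barrier's corner table at a vertical medial vertex, in class coordinates:
`NW = E₂(x+e₁)`, `NE = E₃(x+e₁)`, `SE = E₀(x)`, `SW = E₁(x)`. [folklore] -/
theorem medialCornersAt_vertical (x : Site 2) :
    F (medialCornersAt x 1 0) = E2 F (x + e₁) ∧ F (medialCornersAt x 1 1) = E3 F (x + e₁) ∧
      F (medialCornersAt x 1 2) = E0 F x ∧ F (medialCornersAt x 1 3) = E1 F x := by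
  have q : (x + e₁ - e₀ - e₁ : Site 2) = x - e₀ := by abel
  have p0 : medialCornersAt x 1 0 = (x + e₁, x + e₁ - e₀ - e₁) := by
    rw [q]; simp [medialCornersAt]
  have p1 : medialCornersAt x 1 1 = (x + e₁, x + e₁ - e₁) := by
    rw [add_sub_cancel_right]; simp [medialCornersAt]
  have p2 : medialCornersAt x 1 2 = (x, x) := by
    simp [medialCornersAt]
  have p3 : medialCornersAt x 1 3 = (x, x - e₀) := by
    simp [medialCornersAt]
  simp only [E0, E1, E2, E3, p0, p1, p2, p3, and_self]

/-- **The vertical relation in harmonics** (an identity for every `F`):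
`4·[F(NW) - F(SE) - i(F(NE) - F(SW))] = 2(H₃(x)+H₃(x+e₁)) - (1-i)(H₀(x+e₁)-H₀(x)) - (1+i)(H₂(x+e₁)-H₂(x))`,
times `-1` — no `H₁`. [folklore] -/
theorem four_mul_halfCR_vertical (x : Site 2) :
    4 * (F (medialCornersAt x 1 0) - F (medialCornersAt x 1 2) -
        Complex.I * (F (medialCornersAt x 1 1) - F (medialCornersAt x 1 3))) =
      -(2 * (H3 F x + H3 F (x + e₁)) - (1 - Complex.I) * (H0 F (x + e₁) - H0 F x) -
        (1 + Complex.I) * (H2 F (x + e₁) - H2 F x)) := by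
  obtain ⟨h0, h1, h2, h3⟩ := medialCornersAt_vertical F x
  rw [h0, h1, h2, h3]
  simp only [H0, H2, H3]
  ring

/-- The printed relation with chirality `i` at `s(x, x+e₁)` ⟺ the `H₁`-free harmonic identity
`(1-i) ∂₁H₀ + (1+i) ∂₁H₂ = 2 (H₃(x) + H₃(x+e₁))`. [folklore] -/
theorem halfCRRelationAt_I_vertical_iff (x : Site 2) :
    HalfCRRelationAt Complex.I F (x, 1) ↔
      (1 - Complex.I) * (H0 F (x + e₁) - H0 F x) + (1 + Complex.I) * (H2 F (x + e₁) - H2 F x) =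
        2 * (H3 F x + H3 F (x + e₁)) := by
  have key := four_mul_halfCR_vertical F x
  simp only [HalfCRRelationAt]
  constructor
  · intro h
    have : 4 * (F (medialCornersAt x 1 0) - F (medialCornersAt x 1 2) -
        Complex.I * (F (medialCornersAt x 1 1) - F (medialCornersAt x 1 3))) = 0 := by
      rw [h]; ring
    rw [this] at key
    linear_combination -key
  · intro h
    have : 4 * (F (medialCornersAt x 1 0) - F (medialCornersAt x 1 2) -
        Complex.I * (F (medialCornersAt x 1 1) - F (medialCornersAt x 1 3))) = 0 := by
      rw [key]; linear_combination h
    have h4 : (4 : ℂ) ≠ 0 := by norm_num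
    have := (mul_eq_zero.1 this).resolve_left h4
    linear_combination this

/-- **The vertex sum at a vertical medial vertex**:
`4 Σ_k F(corner k) = 2(H₀(x)+H₀(x+e₁)) + (1-i)(H₁(x)-H₁(x+e₁)) + (1+i)(H₃(x)-H₃(x+e₁))` — no `H₂`. [folklore] -/
theorem four_mul_sum_medialCornersAt_vertical (x : Site 2) :
    4 * (F (medialCornersAt x 1 0) + F (medialCornersAt x 1 1) + F (medialCornersAt x 1 2) +
        F (medialCornersAt x 1 3)) =
      2 * (H0 F x + H0 F (x + e₁)) + (1 - Complex.I) * (H1 F x - H1 F (x + e₁)) +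
        (1 + Complex.I) * (H3 F x - H3 F (x + e₁)) := by
  obtain ⟨h0, h1, h2, h3⟩ := medialCornersAt_vertical F x
  rw [h0, h1, h2, h3]
  simp only [H0, H1, H3]
  have h := Complex.I_mul_I
  linear_combination (2 * E3 F (x + e₁) + 2 * E1 F x - 2 * E3 F x - 2 * E1 F (x + e₁)) * h

/-! ## The barrier's kernel direction is the `H₁` profile -/

/-- **`vertexKernel i v` is a pure `H₁` profile at `v`:** its harmonics at `v` are
`(H₀, H₁, H₂, H₃) = (0, 4i, 0, 0)` — adding any multiple of it at any site changes `H₁` there and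
nothing the relations see (`HalfCRKernel.halfCRForm_vertexKernel`). [folklore] -/
theorem harmonics_vertexKernel (v : Site 2) :
    H0 (HalfCRKernel.vertexKernel Complex.I v) v = 0 ∧
      H1 (HalfCRKernel.vertexKernel Complex.I v) v = 4 * Complex.I ∧
        H2 (HalfCRKernel.vertexKernel Complex.I v) v = 0 ∧
          H3 (HalfCRKernel.vertexKernel Complex.I v) v = 0 := by
  have hne0 : (v - e₀ : Site 2) ≠ v := by
    intro h; have := congrFun h 0; simp at this
  have hne2 : (v - e₀ - e₁ : Site 2) ≠ v := by
    intro h; have := congrFun h 0; simp at this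
  have hne2' : (v - e₀ - e₁ : Site 2) ≠ v - e₀ := by
    intro h; have := congrFun h 1; simp at this
  have hne3 : (v - e₁ : Site 2) ≠ v := by
    intro h; have := congrFun h 1; simp at this
  have hne3' : (v - e₁ : Site 2) ≠ v - e₀ := by
    intro h; have := congrFun h 0
    simp only [Pi.sub_apply, e₀, e₁, Pi.single_eq_same,
      Pi.single_eq_of_ne (show (0 : Fin 2) ≠ 1 by decide)] at this
    omega
  have hne3'' : (v - e₁ : Site 2) ≠ v - e₀ - e₁ := by
    intro h; have := congrFun h 0
    simp only [Pi.sub_apply, e₀, e₁, Pi.single_eq_same,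
      Pi.single_eq_of_ne (show (0 : Fin 2) ≠ 1 by decide)] at this
    omega
  have v0 : E0 (HalfCRKernel.vertexKernel Complex.I v) v = Complex.I := by
    simp [E0, HalfCRKernel.vertexKernel]
  have v1 : E1 (HalfCRKernel.vertexKernel Complex.I v) v = 1 := by
    simp [E1, HalfCRKernel.vertexKernel, hne0]
  have v2 : E2 (HalfCRKernel.vertexKernel Complex.I v) v = -Complex.I := by
    simp [E2, HalfCRKernel.vertexKernel, hne2, hne2']
  have v3 : E3 (HalfCRKernel.vertexKernel Complex.I v) v = -1 := by
    simp [E3, HalfCRKernel.vertexKernel, hne3, hne3', hne3'']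
  refine ⟨?_, ?_, ?_, ?_⟩
  · simp only [H0, v0, v1, v2, v3]; ring
  · simp only [H1, v0, v1, v2, v3]; ring
  · simp only [H2, v0, v1, v2, v3]; ring
  · simp only [H3, v0, v1, v2, v3]; ring

end Summit.CriticalPhenomena.CardyFormulaZ2.Theorems.EdgeCoherence.Negative.HalfCRHarmonics

end
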